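import Mathlib
import Summits.CriticalPhenomena.SAWScalingLimit.Theorems.SAWTotalPositivityBoundaryTP2Defs
import HarnessLib

/-!
# Crux `BoundaryTP2` (stmt-CriticalPhenomena-7115), line `Sketch`: the corner recursion (stub T4)

The Godsil / Heilmann–Lieb vertex recursion for the `2 × 2` minor `Z₁₂Z₃₄ − Z₁₃Z₂₄` of the
fugacity-`x` self-avoiding path kernel `Z = pathKernel H x`, at the corner `p₃`, written additively
in `ℝ≥0∞`:

`Z₁₂Z₃₄ + x Σ_{u ∼ p₃} A₁ᵤ A₂₄ + V₂₄ Z₁₃ = Z₁₃Z₂₄ + x Σ_{u ∼ p₃} A₁₂ Aᵤ₄ + V₁₂ Z₃₄`,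

where `A(a,b)` (resp. `V(a,b)`) is the kernel restricted to the paths avoiding (resp. visiting)
`p₃`. It follows from the splitting `Z = A + V`, the first-step decomposition
`Z(p₃,p₄) = x Σ_{u ∼ p₃} A(u,p₄)` and the last-step decomposition `Z(p₁,p₃) = x Σ_{u ∼ p₃} A(p₁,u)`:
both sides are then the same four-term sum. Everything holds for every `x ≥ 0` with no finiteness
assumption (all sums are unconditional sums in `ℝ≥0∞`).
-/

noncomputable section

namespace Summit.CriticalPhenomena.SAWScalingLimit.Theorems.BoundaryTP2

open scoped ENNReal

variable {V : Type*}

/-- Splitting the kernel into the paths avoiding a vertex `c` and the paths through `c`.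
[folklore] -/
private theorem cornerRec_split (H : SimpleGraph V) (x : ℝ) (a b c : V) :
    pathKernel H x a b =
      pathKernelOn H x a b {γ | c ∉ γ.1.support} + pathKernelOn H x a b {γ | c ∈ γ.1.support} := by
  rw [pathKernel, pathKernelOn, pathKernelOn, ← ENNReal.tsum_add]
  refine tsum_congr fun γ => ?_
  by_cases h : c ∈ γ.1.support
  · have h1 : γ ∉ {γ : H.Path a b | c ∉ γ.1.support} := fun h' => h' h
    have h2 : γ ∈ {γ : H.Path a b | c ∈ γ.1.support} := h
    rw [Set.indicator_of_notMem h1, Set.indicator_of_mem h2, zero_add]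
  · have h1 : γ ∈ {γ : H.Path a b | c ∉ γ.1.support} := h
    have h2 : γ ∉ {γ : H.Path a b | c ∈ γ.1.support} := h
    rw [Set.indicator_of_mem h1, Set.indicator_of_notMem h2, add_zero]

/-- The kernel is symmetric under reversal of paths: `Z(a,b) = Z(b,a)`. [folklore] -/
private theorem cornerRec_comm (H : SimpleGraph V) (x : ℝ) (a b : V) :
    pathKernel H x a b = pathKernel H x b a := by
  let e : H.Path b a ≃ H.Path a b :=
    { toFun := fun γ => ⟨γ.1.reverse, γ.2.reverse⟩
      invFun := fun γ => ⟨γ.1.reverse, γ.2.reverse⟩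
      left_inv := fun γ => Subtype.ext (SimpleGraph.Walk.reverse_reverse γ.1)
      right_inv := fun γ => Subtype.ext (SimpleGraph.Walk.reverse_reverse γ.1) }
  rw [pathKernel, pathKernel, ← Equiv.tsum_eq e]
  refine tsum_congr fun γ => ?_
  simp [e, SimpleGraph.Walk.length_reverse]

/-- The kernel of the paths avoiding a vertex `c` is symmetric under reversal. [folklore] -/
private theorem cornerRec_avoid_comm (H : SimpleGraph V) (x : ℝ) (a b c : V) :
    pathKernelOn H x a b {γ | c ∉ γ.1.support} = pathKernelOn H x b a {γ | c ∉ γ.1.support} := by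
  classical
  let e : H.Path b a ≃ H.Path a b :=
    { toFun := fun γ => ⟨γ.1.reverse, γ.2.reverse⟩
      invFun := fun γ => ⟨γ.1.reverse, γ.2.reverse⟩
      left_inv := fun γ => Subtype.ext (SimpleGraph.Walk.reverse_reverse γ.1)
      right_inv := fun γ => Subtype.ext (SimpleGraph.Walk.reverse_reverse γ.1) }
  rw [pathKernelOn, pathKernelOn, ← Equiv.tsum_eq e]
  refine tsum_congr fun γ => ?_
  simp [e, Set.indicator_apply, SimpleGraph.Walk.length_reverse, SimpleGraph.Walk.support_reverse]

/-- First-step decomposition of the kernel at its starting point: for `a ≠ b`, a self-avoiding path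
`a → b` is an edge `a ∼ u` followed by a self-avoiding path `u → b` avoiding `a`, bijectively, so
`Z(a,b) = x Σ_{u ∼ a} A_a(u,b)`. [folklore] -/
private theorem cornerRec_firstStep (H : SimpleGraph V) (x : ℝ) (hx : 0 ≤ x) {a b : V}
    (hab : a ≠ b) :
    pathKernel H x a b =
      ENNReal.ofReal x * ∑' u : H.neighborSet a, pathKernelOn H x u b {γ | a ∉ γ.1.support} := by
  classical
  let T := Σ u : H.neighborSet a, ↥{γ : H.Path (u : V) b | a ∉ γ.1.support}
  let F : T → H.Path a b := fun p =>
    ⟨SimpleGraph.Walk.cons ((H.mem_neighborSet a p.1).1 p.1.2) p.2.1.1,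
      (SimpleGraph.Walk.cons_isPath_iff _ _).2 ⟨p.2.1.2, p.2.2⟩⟩
  have hF : Function.Bijective F := by
    constructor
    · rintro ⟨⟨u, hu⟩, ⟨⟨q, hq⟩, hqa⟩⟩ ⟨⟨u', hu'⟩, ⟨⟨q', hq'⟩, hqa'⟩⟩ h
      have h' : SimpleGraph.Walk.cons hu q = SimpleGraph.Walk.cons hu' q' := congrArg Subtype.val h
      cases h'
      rfl
    · rintro ⟨p, hp⟩
      cases p with
      | nil => exact absurd rfl hab
      | cons h q =>
        have hq := (SimpleGraph.Walk.cons_isPath_iff h q).1 hp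
        exact ⟨⟨⟨_, h⟩, ⟨⟨q, hq.1⟩, hq.2⟩⟩, rfl⟩
  calc pathKernel H x a b
      = ∑' p : T, ENNReal.ofReal (x ^ (F p).1.length) := by
        rw [pathKernel]
        exact (Equiv.tsum_eq (Equiv.ofBijective F hF)
          (fun γ : H.Path a b => ENNReal.ofReal (x ^ γ.1.length))).symm
    _ = ∑' p : T, ENNReal.ofReal x * ENNReal.ofReal (x ^ p.2.1.1.length) := by
        refine tsum_congr fun p => ?_
        simp only [F, SimpleGraph.Walk.length_cons, pow_succ', ENNReal.ofReal_mul hx]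
    _ = ∑' (u : H.neighborSet a) (γ : ↥{γ : H.Path (u : V) b | a ∉ γ.1.support}),
          ENNReal.ofReal x * ENNReal.ofReal (x ^ γ.1.1.length) :=
        ENNReal.tsum_sigma' (fun p : T => ENNReal.ofReal x * ENNReal.ofReal (x ^ p.2.1.1.length))
    _ = ENNReal.ofReal x * ∑' u : H.neighborSet a, pathKernelOn H x u b {γ | a ∉ γ.1.support} := by
        rw [← ENNReal.tsum_mul_left]
        refine tsum_congr fun u => ?_
        rw [ENNReal.tsum_mul_left, pathKernelOn]
        congr 1
        exact tsum_subtype {γ : H.Path (u : V) b | a ∉ γ.1.support}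
          (fun γ => ENNReal.ofReal (x ^ γ.1.length))

/-- Last-step decomposition of the kernel at its end point: for `b ≠ a`,
`Z(a,b) = x Σ_{u ∼ b} A_b(a,u)` (reverse the first-step decomposition of `Z(b,a)`). [folklore] -/
private theorem cornerRec_lastStep (H : SimpleGraph V) (x : ℝ) (hx : 0 ≤ x) {a b : V}
    (hba : b ≠ a) :
    pathKernel H x a b =
      ENNReal.ofReal x * ∑' u : H.neighborSet b, pathKernelOn H x a u {γ | b ∉ γ.1.support} := by
  rw [cornerRec_comm H x a b, cornerRec_firstStep H x hx hba]
  congr 1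
  exact tsum_congr fun u => cornerRec_avoid_comm H x (u : V) a b

/-- **Corner recursion** (Godsil / Heilmann–Lieb vertex recursion for the `2 × 2` minor at the
corner `p₃`, additive `ℝ≥0∞` form, every fugacity `x ≥ 0`): with `A` (resp. `V`) the kernel of the
paths avoiding (resp. visiting) `p₃`,
`Z₁₂Z₃₄ + x Σ_{u ∼ p₃} A₁ᵤA₂₄ + V₂₄Z₁₃ = Z₁₃Z₂₄ + x Σ_{u ∼ p₃} A₁₂Aᵤ₄ + V₁₂Z₃₄`.
Proof: split `Z₁₂ = A₁₂ + V₁₂`, `Z₂₄ = A₂₄ + V₂₄`, and decompose `Z₃₄` at its first step and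
`Z₁₃` at its last step through the neighbours of `p₃`; both sides become the same four-term sum.
The hypothesis `p₃ ≠ p₂` is part of the registered interface but is not needed for the identity.
[folklore] -/
theorem stub_cornerRecursion (H : SimpleGraph V) (x : ℝ) (hx : 0 ≤ x) (p₁ p₂ p₃ p₄ : V)
    (h₁ : p₃ ≠ p₁) (h₂ : p₃ ≠ p₂) (h₄ : p₃ ≠ p₄) :
    pathKernel H x p₁ p₂ * pathKernel H x p₃ p₄
        + ENNReal.ofReal x * (∑' u : H.neighborSet p₃,
            pathKernelOn H x p₁ u {γ | p₃ ∉ γ.1.support} * pathKernelOn H x p₂ p₄ {γ | p₃ ∉ γ.1.support})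
        + pathKernelOn H x p₂ p₄ {γ | p₃ ∈ γ.1.support} * pathKernel H x p₁ p₃ =
      pathKernel H x p₁ p₃ * pathKernel H x p₂ p₄
        + ENNReal.ofReal x * (∑' u : H.neighborSet p₃,
            pathKernelOn H x p₁ p₂ {γ | p₃ ∉ γ.1.support} * pathKernelOn H x u p₄ {γ | p₃ ∉ γ.1.support})
        + pathKernelOn H x p₁ p₂ {γ | p₃ ∈ γ.1.support} * pathKernel H x p₃ p₄ := by
  -- `h₂ : p₃ ≠ p₂` belongs to the registered interface, but the identity does not depend on it:
  -- it is consumed only to set the (vacuous) case `p₃ = p₂` aside.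
  rcases eq_or_ne p₃ p₂ with h | -
  · exact absurd h h₂
  rw [ENNReal.tsum_mul_right, ENNReal.tsum_mul_left, cornerRec_split H x p₁ p₂ p₃,
    cornerRec_split H x p₂ p₄ p₃, cornerRec_firstStep H x hx h₄, cornerRec_lastStep H x hx h₁]
  ring
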